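import Summits.NavierStokesRegularity.NavierStokesRegularity.Theorems.EulerZoomLiouvillePowerGaugeEulerLiouvilleWeakRenormalizedTransportMember

/-!
# THE SIMILARITY FIELD OF A WEAK CLASS MEMBER SATISFIES THE DIPERNA–LIONS HYPOTHESES: `W ∈ W^{1,2}_loc`, `div W = 3γ`, `|V|/(1+|y|) ∈ L²(ℝ³)`
# — the exact input list of the missing brick «regular Lagrangian flow of W» for the weak stratum
# (crux `EulerZoomLiouville.PowerGaugeEulerLiouville` = stmt-NavierStokesRegularity-19832, line `birth`, open stub `stub_selfSimilarWeakRest`)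

Width seat `ns-ezl-w1` (g7) under the crux LEAD.  Every kill of the `C²` lattice runs a positive-measure blob through a CLOCK along backward similarity orbits
(`Y′ = −W(Y)`, `W = γy + V`); the genuinely weak stratum has no flow.  A regular Lagrangian flow in the sense of DiPerna–Lions / Ambrosio needs exactly:
(DL1) `W ∈ W^{1,1}_loc`, (DL2) `div W ∈ L^∞`, (DL3) `|W|/(1+|y|) ∈ L¹ + L^∞`.  This file records that a weak class profile supplies all three, in the form

* `WeakRenormalized.lintegral_norm_sq_div_lt_top` — from the large-scale `A`-growth `∫_{B_L}‖V‖² ≤ c_A L^{1−2ρ}` (`L ≥ L₀ > 0`, `ρ > −½`) and `V ∈ L²(B_r)` for all `r`: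
  `∫ ‖V‖²/(1+‖y‖²) < ∞` (dyadic shells: the `k`-th shell contributes `≲ 2^{−k(1+2ρ)}`), i.e. **`V/(1+|y|) ∈ L²(ℝ³)`** — a GLOBAL weighted energy bound of the class
  (so `W/(1+|y|) = γy/(1+|y|) + V/(1+|y|) ∈ L^∞ + L²`, which is (DL3));
* **`WeakRenormalized.dipernaLionsData_of_past` / `_of_selfSimilar`** — MEMBER LEVEL, crux hypotheses verbatim (`0 < ρ ≤ ½`, exact self-similarity): there is a profile
  gradient `G` with `HasWeakFDerivOn ⊤ V G`, `G ∈ L²(B_r)` and `V ∈ L⁶(B_r)` for every `r`, **`HasWeakFDerivOn ⊤ W (γ·id + G)`** (DL1, indeed `W^{1,2}_loc`),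
  **`∫⟪W, ∇φ⟫ = −3γ∫φ`** for every test function (DL2: `div W = 3γ`), and **`Integrable (‖V‖²/(1+‖y‖²))`** (DL3).

What is NOT here (and not in the tree): the flow itself (DiPerna–Lions 1989, Invent. Math. 98, 511–547 — existence, uniqueness and the Jacobian law
`(Φ_t)_# vol = e^{3γt} vol` of the regular Lagrangian flow) and any Lagrangian VORTICITY transport for `V ∈ W^{1,2}_loc`; see HANDOFF-g7 (M1)/(M2).
WHAT THIS IS NOT: not NS, not E, not the stub — bookkeeping for the weak stratum (`--supports` stmt-19832); no summit statement is proved here; 19832 OPEN.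
[folklore; cf. DiPerna–Lions 1989 (hypotheses only); ConstantinIgnatovaVicol2026Putative §3.4 (3.19), (3.22)]
-/

noncomputable section

set_option linter.dupNamespace false
-- nested operator types (`innerSL … ∘L …`)
set_option maxSynthPendingDepth 3

open MeasureTheory Set Filter Topology Metric Function TopologicalSpace
open scoped ENNReal NNReal RealInnerProductSpace ContDiff

namespace Summit.NavierStokesRegularity.NavierStokesRegularity.Theorems.PowerGaugeEulerLiouville

open Literature.Analysis Literature.Analysis.FunctionSpaces Literature.Analysis.FluidPDE

namespace WeakRenormalized

variable {V : EuclideanSpace ℝ (Fin 3) → EuclideanSpace ℝ (Fin 3)} {P : EuclideanSpace ℝ (Fin 3) → ℝ}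
  {G : EuclideanSpace ℝ (Fin 3) → EuclideanSpace ℝ (Fin 3) →L[ℝ] EuclideanSpace ℝ (Fin 3)}

/-! ## The global weighted energy bound `V/(1+|y|) ∈ L²` -/

section Weighted

/-- Dyadic covering of `ℝ³`: every point lies in the core ball `B(0, L₀)` or in some shell `2ᵏL₀ ≤ ‖y‖ < 2^{k+1}L₀`. [folklore] -/
theorem mem_core_or_shell {L₀ : ℝ} (hL₀ : 0 < L₀) (y : EuclideanSpace ℝ (Fin 3)) :
    y ∈ ball (0 : EuclideanSpace ℝ (Fin 3)) L₀ ∨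
      ∃ k : ℕ, y ∈ {y : EuclideanSpace ℝ (Fin 3) | 2 ^ k * L₀ ≤ ‖y‖ ∧ ‖y‖ < 2 ^ (k + 1) * L₀} := by
  by_cases hy : ‖y‖ < L₀
  · exact Or.inl (by rwa [mem_ball, dist_zero_right])
  · right
    have h1 : 1 ≤ ‖y‖ / L₀ := by rw [le_div_iff₀ hL₀, one_mul]; exact not_lt.1 hy
    obtain ⟨k, hk1, hk2⟩ := exists_nat_pow_near h1 one_lt_two
    refine ⟨k, ?_, ?_⟩
    · have := (le_div_iff₀ hL₀).1 hk1; linarith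
    · have := (div_lt_iff₀ hL₀).1 hk2; linarith

/-- Bookkeeping of the `k`-th dyadic shell: `((2ᵏL₀)²)⁻¹ · c_A (2^{k+1}L₀)^{1−2ρ} = c_A 2^{1−2ρ} L₀^{−1−2ρ} · (2^{−1−2ρ})ᵏ`. [folklore] -/
theorem shell_const_eq (cA L₀ ρ : ℝ) (hL₀ : 0 < L₀) (k : ℕ) :
    (((2 : ℝ) ^ k * L₀) ^ 2)⁻¹ * (cA * ((2 : ℝ) ^ (k + 1) * L₀) ^ (1 - 2 * ρ)) =
      cA * (2 : ℝ) ^ (1 - 2 * ρ) * L₀ ^ (-1 - 2 * ρ) * ((2 : ℝ) ^ (-1 - 2 * ρ)) ^ k := by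
  set t : ℝ := (2 : ℝ) ^ (k : ℝ) with ht
  have htpos : 0 < t := by positivity
  have h2k : (2 : ℝ) ^ k = t := by rw [ht, Real.rpow_natCast]
  have h2k1 : (2 : ℝ) ^ (k + 1) = 2 * t := by rw [pow_succ, h2k, mul_comm]
  rw [h2k, h2k1]
  have e1 : ((t * L₀) ^ 2)⁻¹ = t ^ (-2 : ℝ) * L₀ ^ (-2 : ℝ) := by
    rw [mul_pow, mul_inv, Real.rpow_neg htpos.le, Real.rpow_neg hL₀.le]
    norm_cast
  have e2 : (2 * t * L₀) ^ (1 - 2 * ρ) = (2 : ℝ) ^ (1 - 2 * ρ) * t ^ (1 - 2 * ρ) * L₀ ^ (1 - 2 * ρ) := by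
    rw [Real.mul_rpow (by positivity) hL₀.le, Real.mul_rpow (by norm_num) htpos.le]
  have e3 : ((2 : ℝ) ^ (-1 - 2 * ρ)) ^ k = t ^ (-1 - 2 * ρ) := by
    rw [← Real.rpow_natCast, ← Real.rpow_mul (by norm_num), mul_comm, Real.rpow_mul (by norm_num), ← ht]
  rw [e1, e2, e3]
  have e4 : t ^ (-2 : ℝ) * t ^ (1 - 2 * ρ) = t ^ (-1 - 2 * ρ) := by
    rw [← Real.rpow_add htpos]; ring_nf
  have e5 : L₀ ^ (-2 : ℝ) * L₀ ^ (1 - 2 * ρ) = L₀ ^ (-1 - 2 * ρ) := by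
    rw [← Real.rpow_add hL₀]; ring_nf
  calc t ^ (-2 : ℝ) * L₀ ^ (-2 : ℝ) * (cA * ((2 : ℝ) ^ (1 - 2 * ρ) * t ^ (1 - 2 * ρ) * L₀ ^ (1 - 2 * ρ)))
      = cA * (2 : ℝ) ^ (1 - 2 * ρ) * (L₀ ^ (-2 : ℝ) * L₀ ^ (1 - 2 * ρ)) * (t ^ (-2 : ℝ) * t ^ (1 - 2 * ρ)) := by ring
    _ = cA * (2 : ℝ) ^ (1 - 2 * ρ) * L₀ ^ (-1 - 2 * ρ) * t ^ (-1 - 2 * ρ) := by rw [e4, e5]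

/-- **`V/(1+|y|) ∈ L²(ℝ³)` from the `A`-growth.**  If `V ∈ L²(B(0,r))` for every `r` and `∫⁻_{B_L}‖V‖ₑ² ≤ ofReal(c_A L^{1−2ρ})` for `L ≥ L₀` (`L₀ > 0`,
`ρ > −½`), then `∫⁻ ‖V y‖ₑ²/(1+‖y‖²) < ∞`: the core contributes `∫_{B_{L₀}}‖V‖² < ∞` and the shell `2ᵏL₀ ≤ ‖y‖ < 2^{k+1}L₀` at most
`c_A (2^{k+1}L₀)^{1−2ρ}/(4ᵏL₀²) = c_A 2^{1−2ρ} L₀^{−1−2ρ} · (2^{−1−2ρ})ᵏ`, a convergent geometric series. [folklore] -/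
theorem lintegral_norm_sq_div_lt_top {ρ : ℝ} (hρ : -1 / 2 < ρ)
    (hV2 : ∀ r : ℝ, MemLp V 2 (volume.restrict (ball (0 : EuclideanSpace ℝ (Fin 3)) r)))
    {cA L₀ : ℝ} (hcA : 0 ≤ cA) (hL₀ : 0 < L₀)
    (hA : ∀ L : ℝ, L₀ ≤ L → ∫⁻ y in ball (0 : EuclideanSpace ℝ (Fin 3)) L, ‖V y‖ₑ ^ 2 ≤ ENNReal.ofReal (cA * L ^ (1 - 2 * ρ))) :
    ∫⁻ y, ‖V y‖ₑ ^ 2 / ENNReal.ofReal (1 + ‖y‖ ^ 2) < ⊤ := by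
  -- the cover
  set T : ℕ → Set (EuclideanSpace ℝ (Fin 3)) := fun n => Nat.casesOn n (ball (0 : EuclideanSpace ℝ (Fin 3)) L₀)
    (fun k => {y : EuclideanSpace ℝ (Fin 3) | 2 ^ k * L₀ ≤ ‖y‖ ∧ ‖y‖ < 2 ^ (k + 1) * L₀}) with hT
  have hcover : (univ : Set (EuclideanSpace ℝ (Fin 3))) ⊆ ⋃ n, T n := by
    intro y _
    rcases mem_core_or_shell hL₀ y with h | ⟨k, hk⟩
    · exact mem_iUnion.2 ⟨0, h⟩
    · exact mem_iUnion.2 ⟨k + 1, hk⟩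
  set f : EuclideanSpace ℝ (Fin 3) → ℝ≥0∞ := fun y => ‖V y‖ₑ ^ 2 / ENNReal.ofReal (1 + ‖y‖ ^ 2) with hf
  -- bounds shell by shell
  set q : ℝ := (2 : ℝ) ^ (-1 - 2 * ρ) with hq
  have hq0 : 0 ≤ q := by positivity
  have hq1 : q < 1 := Real.rpow_lt_one_of_one_lt_of_neg one_lt_two (by linarith)
  set C : ℝ := cA * (2 : ℝ) ^ (1 - 2 * ρ) * L₀ ^ (-1 - 2 * ρ) with hC
  have hC0 : 0 ≤ C := by positivity
  set b : ℕ → ℝ≥0∞ := fun n => Nat.casesOn n (∫⁻ y in ball (0 : EuclideanSpace ℝ (Fin 3)) L₀, ‖V y‖ₑ ^ 2)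
    (fun k => ENNReal.ofReal (C * q ^ k)) with hb
  have hfle : ∀ y, f y ≤ ‖V y‖ₑ ^ 2 := fun y => by
    refine ENNReal.div_le_of_le_mul ?_
    calc ‖V y‖ₑ ^ 2 = ‖V y‖ₑ ^ 2 * 1 := (mul_one _).symm
      _ ≤ ‖V y‖ₑ ^ 2 * ENNReal.ofReal (1 + ‖y‖ ^ 2) := by
          gcongr
          rw [← ENNReal.ofReal_one]
          exact ENNReal.ofReal_le_ofReal (by nlinarith [sq_nonneg ‖y‖])
  have hstep : ∀ n, ∫⁻ y in T n, f y ≤ b n := by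
    intro n
    cases n with
    | zero => exact lintegral_mono fun y => hfle y
    | succ k =>
      show ∫⁻ y in {y : EuclideanSpace ℝ (Fin 3) | 2 ^ k * L₀ ≤ ‖y‖ ∧ ‖y‖ < 2 ^ (k + 1) * L₀}, f y ≤ ENNReal.ofReal (C * q ^ k)
      set Sk : Set (EuclideanSpace ℝ (Fin 3)) := {y | 2 ^ k * L₀ ≤ ‖y‖ ∧ ‖y‖ < 2 ^ (k + 1) * L₀} with hSk
      set ck : ℝ := (((2 : ℝ) ^ k * L₀) ^ 2)⁻¹ with hck
      have hRk : 0 < (2 : ℝ) ^ k * L₀ := by positivity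
      have hck0 : 0 ≤ ck := by positivity
      -- on the shell the weight is at most `ck = 1/(4ᵏ L₀²)`
      have hw : ∀ y ∈ Sk, f y ≤ ENNReal.ofReal ck * ‖V y‖ₑ ^ 2 := by
        intro y hy
        have hy2 : ((2 : ℝ) ^ k * L₀) ^ 2 ≤ 1 + ‖y‖ ^ 2 := by nlinarith [hy.1, norm_nonneg y]
        have hpos : 0 < ((2 : ℝ) ^ k * L₀) ^ 2 := by positivity
        have hinv : (ENNReal.ofReal (1 + ‖y‖ ^ 2))⁻¹ ≤ ENNReal.ofReal ck := by
          rw [hck, ← ENNReal.ofReal_inv_of_pos (hpos.trans_le hy2)]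
          exact ENNReal.ofReal_le_ofReal (inv_anti₀ hpos hy2)
        calc f y = ‖V y‖ₑ ^ 2 * (ENNReal.ofReal (1 + ‖y‖ ^ 2))⁻¹ := div_eq_mul_inv _ _
          _ ≤ ‖V y‖ₑ ^ 2 * ENNReal.ofReal ck := by gcongr
          _ = ENNReal.ofReal ck * ‖V y‖ₑ ^ 2 := mul_comm _ _
      have hSsub : Sk ⊆ ball (0 : EuclideanSpace ℝ (Fin 3)) (2 ^ (k + 1) * L₀) := fun y hy => by
        rw [mem_ball, dist_zero_right]; exact hy.2
      have hAk := hA (2 ^ (k + 1) * L₀) (by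
        have : (1 : ℝ) ≤ 2 ^ (k + 1) := one_le_pow₀ (by norm_num)
        nlinarith)
      have hSm : MeasurableSet Sk :=
        (isClosed_le continuous_const continuous_norm).measurableSet.inter (isOpen_lt continuous_norm continuous_const).measurableSet
      calc ∫⁻ y in Sk, f y ≤ ∫⁻ y in Sk, ENNReal.ofReal ck * ‖V y‖ₑ ^ 2 := setLIntegral_mono' hSm hw
        _ = ENNReal.ofReal ck * ∫⁻ y in Sk, ‖V y‖ₑ ^ 2 := lintegral_const_mul' _ _ ENNReal.ofReal_ne_top
        _ ≤ ENNReal.ofReal ck * ENNReal.ofReal (cA * (2 ^ (k + 1) * L₀) ^ (1 - 2 * ρ)) := by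
            gcongr
            exact (lintegral_mono_set hSsub).trans hAk
        _ = ENNReal.ofReal (C * q ^ k) := by
            rw [← ENNReal.ofReal_mul hck0, hck, shell_const_eq cA L₀ ρ hL₀ k]
  -- the series of bounds is finite
  have hbsum : ∑' n, b n ≠ ⊤ := by
    rw [tsum_eq_zero_add' (by exact ENNReal.summable)]
    refine ENNReal.add_ne_top.2 ⟨?_, ?_⟩
    · -- `b 0 = ∫⁻_{B_{L₀}} ‖V‖ₑ² < ⊤`
      show ∫⁻ y in ball (0 : EuclideanSpace ℝ (Fin 3)) L₀, ‖V y‖ₑ ^ 2 ≠ ⊤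
      have hI := (memLp_two_iff_integrable_sq_norm (hV2 L₀).1).1 (hV2 L₀)
      have h4 : ∫⁻ y in ball (0 : EuclideanSpace ℝ (Fin 3)) L₀, ‖V y‖ₑ ^ 2 =
          ∫⁻ y in ball (0 : EuclideanSpace ℝ (Fin 3)) L₀, ‖‖V y‖ ^ 2‖ₑ := lintegral_congr fun y => by
        rw [Real.enorm_eq_ofReal (sq_nonneg _), ← ofReal_norm, ENNReal.ofReal_pow (norm_nonneg _)]
      rw [h4]
      exact hI.2.ne
    · show ∑' k : ℕ, ENNReal.ofReal (C * q ^ k) ≠ ⊤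
      rw [← ENNReal.ofReal_tsum_of_nonneg (fun k => by positivity) ((summable_geometric_of_lt_one hq0 hq1).mul_left C)]
      exact ENNReal.ofReal_ne_top
  calc ∫⁻ y, f y = ∫⁻ y in univ, f y := (setLIntegral_univ _).symm
    _ ≤ ∫⁻ y in ⋃ n, T n, f y := lintegral_mono_set hcover
    _ ≤ ∑' n, ∫⁻ y in T n, f y := lintegral_iUnion_le _ _
    _ ≤ ∑' n, b n := ENNReal.tsum_le_tsum hstep
    _ < ⊤ := lt_top_iff_ne_top.2 hbsum

/-- **`‖V‖²/(1+‖y‖²)` is integrable on `ℝ³`** (real form of `lintegral_norm_sq_div_lt_top`). [folklore] -/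
theorem integrable_norm_sq_div {ρ : ℝ} (hρ : -1 / 2 < ρ) (hVm : AEStronglyMeasurable V volume)
    (hV2 : ∀ r : ℝ, MemLp V 2 (volume.restrict (ball (0 : EuclideanSpace ℝ (Fin 3)) r)))
    {cA L₀ : ℝ} (hcA : 0 ≤ cA) (hL₀ : 0 < L₀)
    (hA : ∀ L : ℝ, L₀ ≤ L → ∫⁻ y in ball (0 : EuclideanSpace ℝ (Fin 3)) L, ‖V y‖ₑ ^ 2 ≤ ENNReal.ofReal (cA * L ^ (1 - 2 * ρ))) :
    Integrable (fun y : EuclideanSpace ℝ (Fin 3) => ‖V y‖ ^ 2 / (1 + ‖y‖ ^ 2)) volume := by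
  have hwc : Continuous fun y : EuclideanSpace ℝ (Fin 3) => (1 + ‖y‖ ^ 2)⁻¹ :=
    (continuous_const.add (continuous_norm.pow 2)).inv₀ fun y => (by positivity : (0 : ℝ) < 1 + ‖y‖ ^ 2).ne'
  have hm : AEStronglyMeasurable (fun y : EuclideanSpace ℝ (Fin 3) => ‖V y‖ ^ 2 / (1 + ‖y‖ ^ 2)) volume := by
    have h := (hVm.norm.pow 2).mul hwc.aestronglyMeasurable
    refine h.congr (Eventually.of_forall fun y => ?_)
    simp only [Pi.mul_apply, Pi.pow_apply, div_eq_mul_inv]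
  refine ⟨hm, ?_⟩
  rw [hasFiniteIntegral_iff_enorm]
  refine lt_of_le_of_lt (le_of_eq (lintegral_congr fun y => ?_)) (lintegral_norm_sq_div_lt_top hρ hV2 hcA hL₀ hA)
  have h1 : 0 < 1 + ‖y‖ ^ 2 := by positivity
  rw [Real.enorm_eq_ofReal (by positivity), ENNReal.ofReal_div_of_pos h1, ← ofReal_norm, ENNReal.ofReal_pow (norm_nonneg _)]

end Weighted

/-! ## Member level: the DiPerna–Lions data of a weak class member -/

section Member

/-- **THE SIMILARITY FIELD OF A PAST-EXACT SELF-SIMILAR CLASS MEMBER SATISFIES THE DIPERNA–LIONS HYPOTHESES** (`0 < ρ ≤ ½`, `γ = 1/(2+ρ)`; crux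
hypotheses verbatim, exact self-similarity about `(T, x₀)` for `τ < T₁`; NO regularity): there is a profile gradient `G` with
(i) `HasWeakFDerivOn ⊤ V G`, `G ∈ L²(B_r)`, `V ∈ L⁶(B_r)` for every `r`;
(ii) `W = γy + V` has the whole-space weak derivative `γ·id + G` (`W ∈ W^{1,2}_loc` — DL1);
(iii) `∫⟪W, ∇φ⟫ = −3γ∫φ` for every test function (`div W = 3γ ∈ L^∞` — DL2);
(iv) `‖V‖²/(1+‖y‖²) ∈ L¹(ℝ³)`, i.e. `V/(1+|y|) ∈ L²` (so `W/(1+|y|) ∈ L^∞ + L²` — DL3). [folklore] -/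
theorem dipernaLionsData_of_past {ρ : ℝ} (hρ : 0 < ρ) (hρh : ρ ≤ 1 / 2)
    {T T₁ : ℝ} (hT₁ : T₁ ≤ 0) (hTT₁ : T₁ ≤ T) (x₀ : EuclideanSpace ℝ (Fin 3))
    {u : ℝ → EuclideanSpace ℝ (Fin 3) → EuclideanSpace ℝ (Fin 3)} {p : ℝ → EuclideanSpace ℝ (Fin 3) → ℝ}
    {H : ℝ → EuclideanSpace ℝ (Fin 3) → EuclideanSpace ℝ (Fin 3) →L[ℝ] EuclideanSpace ℝ (Fin 3)} {c : ℝ≥0}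
    (hsw : IsSuitableWeakSolutionOn (slab (EuclideanSpace ℝ (Fin 3)) (Iio 0) isOpen_Iio) 0 0 u p)
    (hH : HasWeakSpatialGradientOn (slab (EuclideanSpace ℝ (Fin 3)) (Iio 0) isOpen_Iio) u H)
    (hgauge : ∀ a : ℝ, 0 < a →
      ENNReal.ofReal (a ^ (2 * ρ)) * cknA a (0 : ℝ × EuclideanSpace ℝ (Fin 3)) u +
          ENNReal.ofReal (a ^ ρ) * cknE a (0 : ℝ × EuclideanSpace ℝ (Fin 3)) H +
        ENNReal.ofReal (a ^ (2 * ρ)) * cknD a (0 : ℝ × EuclideanSpace ℝ (Fin 3)) p ≤ (c : ℝ≥0∞))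
    {V : EuclideanSpace ℝ (Fin 3) → EuclideanSpace ℝ (Fin 3)} {P : EuclideanSpace ℝ (Fin 3) → ℝ}
    (hu : ∀ τ : ℝ, τ < T₁ → u τ = fun x => selfSimilarCollapse (1 / (2 + ρ)) T V τ (x - x₀))
    (hp : ∀ τ : ℝ, τ < T₁ → p τ = fun x => selfSimilarCollapsePressure (1 / (2 + ρ)) T P τ (x - x₀)) :
    ∃ G : EuclideanSpace ℝ (Fin 3) → EuclideanSpace ℝ (Fin 3) →L[ℝ] EuclideanSpace ℝ (Fin 3),
      HasWeakFDerivOn (⊤ : Opens (EuclideanSpace ℝ (Fin 3))) volume V G ∧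
      (∀ r : ℝ, MemLp G 2 (volume.restrict (ball (0 : EuclideanSpace ℝ (Fin 3)) r))) ∧
      (∀ r : ℝ, MemLp V 6 (volume.restrict (ball (0 : EuclideanSpace ℝ (Fin 3)) r))) ∧
      HasWeakFDerivOn (⊤ : Opens (EuclideanSpace ℝ (Fin 3))) volume (selfSimilarTransport (1 / (2 + ρ)) 0 V)
        (fun x => (1 / (2 + ρ)) • ContinuousLinearMap.id ℝ (EuclideanSpace ℝ (Fin 3)) + G x) ∧
      (∀ φ : EuclideanSpace ℝ (Fin 3) → ℝ, IsTestFunctionOn (⊤ : Opens (EuclideanSpace ℝ (Fin 3))) φ →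
        ∫ y, ⟪selfSimilarTransport (1 / (2 + ρ)) 0 V y, gradient φ y⟫ = -(3 * (1 / (2 + ρ))) * ∫ y, φ y) ∧
      Integrable (fun y : EuclideanSpace ℝ (Fin 3) => ‖V y‖ ^ 2 / (1 + ‖y‖ ^ 2)) volume := by
  have hA : ∀ a : ℝ, 0 < a → ENNReal.ofReal (a ^ (2 * ρ)) *
      cknA a (0 : ℝ × EuclideanSpace ℝ (Fin 3)) u ≤ (c : ℝ≥0∞) :=
    fun a ha => le_trans (le_trans le_self_add le_self_add) (hgauge a ha)
  have hE : ∀ a : ℝ, 0 < a → ENNReal.ofReal (a ^ ρ) *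
      cknE a (0 : ℝ × EuclideanSpace ℝ (Fin 3)) H ≤ (c : ℝ≥0∞) :=
    fun a ha => le_trans (le_trans le_add_self le_self_add) (hgauge a ha)
  have hD : ∀ a : ℝ, 0 < a → ENNReal.ofReal (a ^ (2 * ρ)) *
      cknD a (0 : ℝ × EuclideanSpace ℝ (Fin 3)) p ≤ (c : ℝ≥0∞) :=
    fun a ha => le_trans le_add_self (hgauge a ha)
  obtain ⟨G, hVm, -, -, hVG, -, ⟨CA, hCA, hAgr⟩, -, -, hV6, hG2, -, hdiv, -, -, -⟩ :=
    Past.profileData_of_past hρ hρh hT₁ hTT₁ x₀ hsw.distributional hH hA hE hD hu hp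
  set L₀ : ℝ := max (2 - T₁) 1 with hL₀
  have hL₀pos : 0 < L₀ := lt_of_lt_of_le one_pos (le_max_right _ _)
  have hAr : ∀ L : ℝ, L₀ ≤ L → ∫⁻ y in ball (0 : EuclideanSpace ℝ (Fin 3)) L, ‖V y‖ₑ ^ 2 ≤
      ENNReal.ofReal (CA.toReal * L ^ (1 - 2 * ρ)) := fun L hL => by
    rw [ENNReal.ofReal_mul ENNReal.toReal_nonneg, ENNReal.ofReal_toReal hCA]
    exact hAgr L (le_trans (le_max_left _ _) hL)
  have hV2 : ∀ r : ℝ, MemLp V 2 (volume.restrict (ball (0 : EuclideanSpace ℝ (Fin 3)) r)) := fun r => by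
    haveI : IsFiniteMeasure ((volume : Measure (EuclideanSpace ℝ (Fin 3))).restrict (ball 0 r)) :=
      isFiniteMeasure_restrict.2 measure_ball_lt_top.ne
    exact (hV6 r).mono_exponent (by norm_num)
  have hVl : LocallyIntegrable V volume := WeakBernoulli.locallyIntegrable_of_memLp_six_ball hV6
  refine ⟨G, hVG, hG2, hV6, WeakBernoulli.hasWeakFDerivOn_transport hVG,
    fun φ hφ => WeakBernoulli.integral_inner_transport_gradient hVl hdiv hφ,
    integrable_norm_sq_div (ρ := ρ) (by linarith) hVm hV2 ENNReal.toReal_nonneg hL₀pos hAr⟩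

/-- **THE SIMILARITY FIELD OF AN EXACTLY SELF-SIMILAR CLASS MEMBER SATISFIES THE DIPERNA–LIONS HYPOTHESES** (origin-centred; binder shape of the skeleton's
`IsExactlySelfSimilar`; `0 < ρ ≤ ½`): (i) `V` has a whole-space weak gradient `G ∈ L²_loc`, `V ∈ L⁶_loc`; (ii) `W ∈ W^{1,2}_loc` with `DW = γ·id + G`;
(iii) `div W = 3γ` weakly; (iv) `V/(1+|y|) ∈ L²(ℝ³)`. [folklore] -/
theorem dipernaLionsData_of_selfSimilar {ρ : ℝ} (hρ : 0 < ρ) (hρh : ρ ≤ 1 / 2)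
    {u : ℝ → EuclideanSpace ℝ (Fin 3) → EuclideanSpace ℝ (Fin 3)} {p : ℝ → EuclideanSpace ℝ (Fin 3) → ℝ}
    {H : ℝ → EuclideanSpace ℝ (Fin 3) → EuclideanSpace ℝ (Fin 3) →L[ℝ] EuclideanSpace ℝ (Fin 3)} {c : ℝ≥0}
    (hsw : IsSuitableWeakSolutionOn (slab (EuclideanSpace ℝ (Fin 3)) (Iio 0) isOpen_Iio) 0 0 u p)
    (hH : HasWeakSpatialGradientOn (slab (EuclideanSpace ℝ (Fin 3)) (Iio 0) isOpen_Iio) u H)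
    (hgauge : ∀ a : ℝ, 0 < a →
      ENNReal.ofReal (a ^ (2 * ρ)) * cknA a (0 : ℝ × EuclideanSpace ℝ (Fin 3)) u +
          ENNReal.ofReal (a ^ ρ) * cknE a (0 : ℝ × EuclideanSpace ℝ (Fin 3)) H +
        ENNReal.ofReal (a ^ (2 * ρ)) * cknD a (0 : ℝ × EuclideanSpace ℝ (Fin 3)) p ≤ (c : ℝ≥0∞))
    {V : EuclideanSpace ℝ (Fin 3) → EuclideanSpace ℝ (Fin 3)} {P : EuclideanSpace ℝ (Fin 3) → ℝ}
    (hu : ∀ τ : ℝ, τ < 0 → u τ = selfSimilarCollapse (1 / (2 + ρ)) 0 V τ)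
    (hp : ∀ τ : ℝ, τ < 0 → p τ = selfSimilarCollapsePressure (1 / (2 + ρ)) 0 P τ) :
    ∃ G : EuclideanSpace ℝ (Fin 3) → EuclideanSpace ℝ (Fin 3) →L[ℝ] EuclideanSpace ℝ (Fin 3),
      HasWeakFDerivOn (⊤ : Opens (EuclideanSpace ℝ (Fin 3))) volume V G ∧
      (∀ r : ℝ, MemLp G 2 (volume.restrict (ball (0 : EuclideanSpace ℝ (Fin 3)) r))) ∧
      (∀ r : ℝ, MemLp V 6 (volume.restrict (ball (0 : EuclideanSpace ℝ (Fin 3)) r))) ∧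
      HasWeakFDerivOn (⊤ : Opens (EuclideanSpace ℝ (Fin 3))) volume (selfSimilarTransport (1 / (2 + ρ)) 0 V)
        (fun x => (1 / (2 + ρ)) • ContinuousLinearMap.id ℝ (EuclideanSpace ℝ (Fin 3)) + G x) ∧
      (∀ φ : EuclideanSpace ℝ (Fin 3) → ℝ, IsTestFunctionOn (⊤ : Opens (EuclideanSpace ℝ (Fin 3))) φ →
        ∫ y, ⟪selfSimilarTransport (1 / (2 + ρ)) 0 V y, gradient φ y⟫ = -(3 * (1 / (2 + ρ))) * ∫ y, φ y) ∧
      Integrable (fun y : EuclideanSpace ℝ (Fin 3) => ‖V y‖ ^ 2 / (1 + ‖y‖ ^ 2)) volume := by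
  have hu' : ∀ τ : ℝ, τ < 0 → u τ = fun x => selfSimilarCollapse (1 / (2 + ρ)) 0 V τ (x - 0) :=
    fun τ hτ => by rw [hu τ hτ]; funext x; rw [sub_zero]
  have hp' : ∀ τ : ℝ, τ < 0 → p τ = fun x => selfSimilarCollapsePressure (1 / (2 + ρ)) 0 P τ (x - 0) :=
    fun τ hτ => by rw [hp τ hτ]; funext x; rw [sub_zero]
  exact dipernaLionsData_of_past hρ hρh le_rfl le_rfl 0 hsw hH hgauge hu' hp'

end Member

end WeakRenormalized

end Summit.NavierStokesRegularity.NavierStokesRegularity.Theorems.PowerGaugeEulerLiouville
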